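import Literature.Geometry.Symplectic.TwoHandleIsotopyReduction
import Literature.Geometry.Symplectic.TwoHandleIsotopyProofs
import Literature.Topology.FourManifolds.LinkIsotopyDiffeotopy
import Literature.Topology.FourManifolds.DiffeotopyExtension
import Literature.Topology.FourManifolds.ImmersionCriterion
import HarnessLib

/-!
# Isotopies of links in `∂W` are covered by diffeotopies of `W` (proof of AMB)

Topic `Literature/Geometry/Symplectic`; proofs file supplying the first of the three classical
inputs (**AMB**, hypothesis `hA`) of the reduction
`isMultiAttachment_of_linkIsotopyInBoundary_of` (`TwoHandleIsotopyReduction.lean`) of the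
isotopy invariance of 2-handle attachment (Kosinski, *Differential Manifolds* (1993), VIII,
proof of (1.2)):

* `exists_diffeotopy_of_linkIsotopyInBoundary` — on a compact (Hausdorff) 4-manifold with
  boundary `W`, an isotopy `Φ` of links in `∂W` all of whose stages lie in `∂W` and are links is
  covered by a diffeotopy `G` of `W`: `G_t ∘ Lᵢ = Φᵢ(t)` for `t ∈ [0, 1]`.

*Proof* (Kosinski II (5.2) in the closed 3-manifold `∂W`, then *"extended over `M`, using the
collar of `∂M`, in the usual way"*, VI §7, proof of (7.2)).  Lift the isotopies to the boundary
manifold `∂W` (`BoundaryManifold.boundaryData`, `Cobordism.lean`; the lifts `knotLift` of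
`TwoHandleIsotopyProofs.lean`, jointly smooth by `BoundaryManifold.contMDiff_codRestrict`, each
stage an embedding by the injective-immersion criterion `ImmersionCriterion.lean`); cover them
by one diffeotopy of `∂W` (`exists_diffeotopy_forall_comp_eq`, `LinkIsotopyDiffeotopy.lean`:
the isotopy extension theorem applied component by component with support control); extend it
over `W` by the collar (`BoundaryData.exists_diffeotopy_comp_incl_eq_of_compactSpace`,
`DiffeotopyExtension.lean`).  Everything is proved; no named facts.

## References

* A. A. Kosinski, *Differential Manifolds* (1993), II (5.2); VI §7, proof of (7.2); VIII, proof of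
  (1.2). [Kosinski1993]
* M. W. Hirsch, *Differential Topology*, GTM 33 (1976), Ch. 8 §1, Thms. 1.3, 1.6. [HirschDT1976]
-/

noncomputable section

open scoped Manifold ContDiff Topology
open Set Function

namespace Literature.Geometry.Symplectic

open Literature.Topology.FourManifolds

/-- Local notation: `𝕊 n` is the unit sphere in `EuclideanSpace ℝ (Fin (n + 1))`. -/
local notation "𝕊 " n:arg => (Metric.sphere (0 : EuclideanSpace ℝ (Fin (n + 1))) 1)

section Lift

variable {W : Type} [TopologicalSpace W] [ChartedSpace (EuclideanHalfSpace 4) W]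
  [IsManifold (𝓡∂ 4) ∞ W]

omit [IsManifold (𝓡∂ 4) ∞ W] in
/-- Every stage of an isotopy of knots all of whose stages lie in `∂W` is a knot in `∂W`.
[folklore] -/
theorem KnotIsotopyInBoundary.isBoundaryKnot_of_forall {K K' : 𝕊 1 → W}
    (Φ : KnotIsotopyInBoundary K K') (hB : ∀ t u, (𝓡∂ 4).IsBoundaryPoint (Φ.toFun t u)) (t : ℝ) :
    IsBoundaryKnot (Φ.toFun t) :=
  ⟨Φ.isSmoothEmbedding t, hB t⟩

/-- **A lifted knot is a smooth embedding into the boundary 3-manifold** (injective immersion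
of the compact `S¹` into the Hausdorff `∂W`: `injective_mfderiv_knotLift`,
`injective_knotLift`, `contMDiff_knotLift` of `TwoHandleIsotopyProofs.lean` with the criterion
`isSmoothEmbedding_of_injective_of_injective_mfderiv`). [folklore] -/
theorem isSmoothEmbedding_knotLift [T2Space W] {K : 𝕊 1 → W} (hK : IsBoundaryKnot K) :
    Manifold.IsSmoothEmbedding (𝓡 1) (𝓡 3) ∞ (knotLift hK) := by
  haveI : T2Space (BoundaryManifold.boundaryData 3 W).carrier :=
    inferInstanceAs (T2Space ((𝓡∂ 4).boundary W))
  exact isSmoothEmbedding_of_injective_of_injective_mfderiv (contMDiff_knotLift hK) (by simp)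
    (injective_knotLift hK) (injective_mfderiv_knotLift hK)

/-- **The lift to `∂W` of an isotopy of knots all of whose stages lie in `∂W`**, as a smooth
isotopy in the boundary 3-manifold. [folklore] -/
def KnotIsotopyInBoundary.lift [T2Space W] {K K' : 𝕊 1 → W} (Φ : KnotIsotopyInBoundary K K')
    (hB : ∀ t u, (𝓡∂ 4).IsBoundaryPoint (Φ.toFun t u)) :
    SmoothIsotopy (𝓡 1) (𝓡 3) (knotLift (Φ.isBoundaryKnot_of_forall hB 0))
      (knotLift (Φ.isBoundaryKnot_of_forall hB 1)) where
  toFun t := knotLift (Φ.isBoundaryKnot_of_forall hB t)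
  contMDiff := BoundaryManifold.contMDiff_codRestrict (fun p => hB p.1 p.2) Φ.contMDiff
  isSmoothEmbedding _ := isSmoothEmbedding_knotLift _
  map_zero := rfl
  map_one := rfl

/-- Stages of the lift, followed by the inclusion. [folklore] -/
theorem KnotIsotopyInBoundary.incl_lift_toFun [T2Space W] {K K' : 𝕊 1 → W}
    (Φ : KnotIsotopyInBoundary K K') (hB : ∀ t u, (𝓡∂ 4).IsBoundaryPoint (Φ.toFun t u)) (t : ℝ)
    (u : 𝕊 1) : (BoundaryManifold.boundaryData 3 W).incl ((Φ.lift hB).toFun t u) = Φ.toFun t u :=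
  rfl

end Lift

/-- **AMB — an isotopy of links in `∂W` is covered by a diffeotopy of `W`** (Kosinski 1993,
II (5.2), the Isotopy Extension Theorem, in the closed manifold `∂W`; then *"extended over `M`,
using the collar of `∂M`, in the usual way"*, VI §7, proof of (7.2); Hirsch 1976, Ch. 8,
Thms. 1.3, 1.6).  For a compact (Hausdorff) 4-manifold with boundary `W`, a finite family of
circles `Lᵢ` and an isotopy `Φ` of links in `∂W` all of whose stages lie in `∂W` and are links,
there is a diffeotopy `G` of `W` with `G_t ∘ Lᵢ = Φᵢ(t)` for `t ∈ [0, 1]`.  This is, binder for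
binder, the hypothesis `hA` of `isMultiAttachment_of_linkIsotopyInBoundary_of`.
[cite: Kosinski1993, II (5.2) and VI §7 proof of (7.2)] -/
theorem exists_diffeotopy_of_linkIsotopyInBoundary (W : Type) [TopologicalSpace W] [T2Space W]
    [ChartedSpace (EuclideanHalfSpace 4) W] [IsManifold (𝓡∂ 4) ∞ W] [CompactSpace W]
    (ι : Type) [Finite ι] (L L' : ι → 𝕊 1 → W) (Φ : LinkIsotopyInBoundary L L')
    (hB : ∀ i t u, (𝓡∂ 4).IsBoundaryPoint ((Φ.isotopy i).toFun t u))
    (hdisj : ∀ t, Pairwise fun i j => Disjoint (range ((Φ.isotopy i).toFun t))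
      (range ((Φ.isotopy j).toFun t))) :
    ∃ G : Diffeotopy (𝓡∂ 4) W, ∀ i, ∀ t ∈ Icc (0 : ℝ) 1, G.toFun t ∘ L i = (Φ.isotopy i).toFun t := by
  set b := BoundaryManifold.boundaryData 3 W with hb
  haveI : CompactSpace b.carrier := b.compactSpace_carrier
  haveI : T2Space b.carrier := inferInstanceAs (T2Space ((𝓡∂ 4).boundary W))
  -- the lifted isotopies in the closed 3-manifold `∂W`
  set ψ := fun i => (Φ.isotopy i).lift (hB i) with hψ
  have hdisjψ : ∀ t ∈ Icc (0 : ℝ) 1, Pairwise fun i j =>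
      Disjoint (range ((ψ i).toFun t)) (range ((ψ j).toFun t)) := by
    intro t _ i j hij
    refine Set.disjoint_left.2 ?_
    rintro _ ⟨u, rfl⟩ ⟨u', hu'⟩
    have hval : (Φ.isotopy j).toFun t u' = (Φ.isotopy i).toFun t u := by
      have := congrArg Subtype.val hu'
      exact this
    exact Set.disjoint_left.1 (hdisj t hij) (mem_range_self u) ⟨u', hval⟩
  -- one diffeotopy of `∂W` covering all of them
  obtain ⟨D, hD⟩ := exists_diffeotopy_forall_comp_eq ψ hdisjψ
  -- extended over `W` by the collar
  obtain ⟨G, hG⟩ := BoundaryData.exists_diffeotopy_comp_incl_eq_of_compactSpace 2 b D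
  refine ⟨G, fun i t ht => funext fun u => ?_⟩
  have h0 : L i u = b.incl ((ψ i).toFun 0 u) := by
    show L i u = (Φ.isotopy i).toFun 0 u
    rw [(Φ.isotopy i).map_zero]
  rw [comp_apply, h0]
  have h1 := congrFun (hG t) ((ψ i).toFun 0 u)
  rw [comp_apply] at h1
  rw [h1, comp_apply]
  have h2 := congrFun (hD i t ht) u
  rw [comp_apply] at h2
  exact (congrArg b.incl h2).trans rfl

end Literature.Geometry.Symplectic

end
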